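import Literature.MathematicalPhysics.QuantumFieldTheory.Balaban1983to89.B9Thm312Whole
import Literature.MathematicalPhysics.QuantumFieldTheory.Balaban1983to89.B9Thm37GlueSz
import HarnessLib

/-!
# Route `UnitScaleTilt` (α), node N06(d = 3), the two record-species consumers `norm_G` ∕ `norm_H₁` — **THE SYMMETRY ROWS `hsymGG` ∕ `hsym` OF THE T³ LEAVES
# FROM THE SECT.-D LETTERS**: 𝔊(U), G(U), G₁(U) are symmetric and (∇_U∘A)ᵗ = A∘∇*_U for A ∈ {𝔊, G, G₁}, for ANY letter record `B9Thm312Whole.Ops` whose `Identities` hold at U and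
# whose four primitive letters Δ_a = `S0`, Δ′_π = `Tpi`, Δ⁽²⁾_π = `T2` are symmetric and (∇_U, ∇*_U) = (`D`, `Dstar`) form a transpose pair

Cell `ym-inputs` (D-0154 (2) «INPUTS → UNCONDITIONAL YM (α)»; desk `ym-inputs-plan-1` INPUT-LIST v5 §4 row p05 = I-06 (d) «the structural rows `hcoR hco1R hcoG hl2N hH1N hIF hsymGG` of
`Prop7SectET3N06LeavesRecordNormG.normG_row_of_recordObligations` for a concrete `𝔬_T3`», clause «before p01's definitions: the symmetry∕transpose-pair row for the abstract `Ops`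
letters if statable»), seat ym-inputs-p05.  Count-neutral helper (`--supports stmt-QuantumFields-20520 --as helper`; RULING g26-№2 «B0 needs N06(d = 3)»); registry untouched;
THEOREMS ONLY (0 `def`, 0 `sorry`); NOTHING of [Balaban1985BackgroundPropagators] is asserted.

THE ROWS.  The T³ leaves of record display, among the obligations of the concrete operator instance, the SYMMETRY rows
`hsymGG : … → IsTransposePair ((𝔬 i).GG U) ((𝔬 i).GG U) ∧ IsTransposePair ((𝔬 i).D U ∘ₗ (𝔬 i).GG U) ((𝔬 i).GG U ∘ₗ (𝔬 i).Dstar U)` (`…N06LeavesRecordNormG.lean:101`, the 𝔊-side,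
Theorem 3.13) and `hsym : … → (IsTransposePair (G U) (G U) ∧ IsTransposePair (G1 U) (G1 U)) ∧ (IsTransposePair (D U ∘ₗ G U) (G U ∘ₗ Dstar U) ∧ IsTransposePair (D U ∘ₗ G1 U) (G1 U ∘ₗ
Dstar U))` (`…N06LeavesRecordNormH1.lean:137`, the H-side, Theorem 3.12), under the printed provisos `M₁ ≤ M`, `0 < α₀`, `Mα₀ ≤ a₁`, (3.35), (3.36).  Print uses these symmetries
tacitly (p. 391: *«The adjoints are taken with respect to natural L² scalar products»*; G = (Δ_π + DRD* + Q*aQ)⁻¹ (3.122), G₁ (3.128) and Δ_a = G₀⁻¹ are defined by quadratic forms;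
𝔊 = G₁𝔓* = 𝔓G₁ (3.153)).  THIS FILE derives both rows, for an ARBITRARY letter record `𝔬 : Ops g B X Y Z W`, from the identity schema `Identities 𝔬 U` (already displayed inside the
leaves' `hmodel` row: `invG`, `invG1`, `eq153`, `c1_inv`, `adjQ`, `adjDv`, `symmR`) and FOUR primitive letter symmetries — `S0`, `Tpi`, `T2` symmetric and (`D`, `Dstar`) a transpose
pair — which for any concrete instance are immediate from the definitions by quadratic forms ∕ adjoints.  So the layer-0 instance (WANTED №g25-1, p01) owes these four facts, not the rows.

WHAT IS PROVED (ns `…Theorems.Prop7SectET3OpsSymmetry`; finite-dimensional transpose algebra over `B9Thm37Glue.IsTransposePair`, `B9Thm37GlueSz.isTransposePair_inv`):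
* §1 one member, one U: `isTransposePair_G` ∕ `isTransposePair_G1` ((T⁻¹)ᵗ = (Tᵗ)⁻¹ on the finite lattice, from `invG` ∕ `invG1`), `isTransposePair_QG1Qstar` and `isTransposePair_C1`
  ((QG₁Q*)⁻¹ symmetric, from `c1_inv`), ★ `isTransposePair_frakPstar_frakP` ((𝔓*)ᵗ = 𝔓, (3.147)∕(3.153)), ★★ `isTransposePair_GG` (𝔊 = G₁𝔓* symmetric via `eq153` and
  `G1_comp_frakPstar`), ★★ `symGG_of_identities` (the `hsymGG` conjunction) and ★★ `symG_G1_of_identities` (the `hsym` conjunction).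
* §2 any index family (`geo : I → B9.Geometry`, `bg : I → B9.Backgrounds`): ★★★ `hsymGG_row_of_letterSymm` and ★★★ `hsym_row_of_letterSymm` — the two displayed rows IN THEIR OWN
  SHAPE (same provisos) from an `Identities` row and a displayed four-conjunct LETTER-SYMMETRY row under the same provisos; at the T³ index (`KIdx 2 ℓ hd3 hL 1 1`, `geo9K`, `bgT3`)
  the `Identities` row is the last conjunct of the leaves' `hmodel`.
HONEST SCOPE: pure linear algebra ([folklore]); no estimate of [B9]; the concrete T³ letters (layer 0: `G(U₀)`, `𝔊(U₀)`, `H(U₀)`, `H₁(U₀)` on the M₂(ℂ) carriers, `Q := Tube^{sym}_cov`)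
are NOT defined here; N06(d = 3) NOT discharged; nothing here claims EX, the crux, d = 4 or the mass gap; YM₃ on T³ is ladder rung R3, not the Clay problem.

References: T. Bałaban, CMP **99** (1985) 389–434 [Balaban1985BackgroundPropagators] (p.391; (3.120)–(3.130) pp.419–421; (3.147) p.425; (3.152)–(3.153) p.426; Thm 3.12 p.423;
Thm 3.13 p.426).
-/

set_option autoImplicit false

namespace Summit.QuantumFields.YangMills.Theorems.Prop7SectET3OpsSymmetry

open Literature.MathematicalPhysics.QuantumFieldTheory.Balaban1983to89
open Literature.MathematicalPhysics.QuantumFieldTheory.Balaban1983to89.B9Thm37Glue (IsTransposePair)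
open Literature.MathematicalPhysics.QuantumFieldTheory.Balaban1983to89.B9Thm37GlueSz (isTransposePair_of_rightInverse isTransposePair_inv)
open Literature.MathematicalPhysics.QuantumFieldTheory.Balaban1983to89.B9Thm312Whole (Ops frakP frakPstar G1_comp_frakPstar Identities)

/-! ## §1 One member, one background configuration -/

section OneMember

variable {g : B9.Geometry} {B : B9.Backgrounds} {X Y Z W : Type} [Fintype X]

/-- The identity map is its own transpose for the component pairing. [folklore] -/
theorem isTransposePair_id : IsTransposePair (LinearMap.id : (X → ℝ) →ₗ[ℝ] (X → ℝ)) LinearMap.id := fun _ _ => rfl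

variable [Fintype Z] [Fintype W]

/-- **G = (Δ_a − Δ′_π)⁻¹ is symmetric** when Δ_a = `S0` and Δ′_π = `Tpi` are: the inverse of a symmetric operator on the finite lattice is symmetric ((3.120)–(3.122): G⁻¹ = Δ_π +
DRD* + Q*aQ = Δ_a − Δ′_π, read from `Identities.invG`). [cite: Balaban1985BackgroundPropagators, (3.120)–(3.122) pp.419–420] -/
theorem isTransposePair_G (𝔬 : Ops g B X Y Z W) (U : B.Cfg) (hI : Identities 𝔬 U)
    (hS0 : IsTransposePair (𝔬.S0 U) (𝔬.S0 U)) (hTpi : IsTransposePair (𝔬.Tpi U) (𝔬.Tpi U)) :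
    IsTransposePair (𝔬.G U) (𝔬.G U) :=
  isTransposePair_inv (hS0.sub hTpi) hI.invG hI.invG

/-- **G₁ = (Δ_a − Δ′_π − Δ⁽²⁾_π)⁻¹ is symmetric** when `S0`, `Tpi`, `T2` are ((3.128), (3.134): read from `Identities.invG1`). [cite: Balaban1985BackgroundPropagators, (3.128) p.421, (3.134)–(3.138) pp.422–423] -/
theorem isTransposePair_G1 (𝔬 : Ops g B X Y Z W) (U : B.Cfg) (hI : Identities 𝔬 U)
    (hS0 : IsTransposePair (𝔬.S0 U) (𝔬.S0 U)) (hTpi : IsTransposePair (𝔬.Tpi U) (𝔬.Tpi U))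
    (hT2 : IsTransposePair (𝔬.T2 U) (𝔬.T2 U)) : IsTransposePair (𝔬.G1 U) (𝔬.G1 U) :=
  isTransposePair_inv (hS0.sub (hTpi.add hT2)) hI.invG1 hI.invG1

/-- **QG₁Q* is symmetric** when G₁ is and Q* is the adjoint of Q (`Identities.adjQ`). [cite: Balaban1985BackgroundPropagators, (3.132) p.422] -/
theorem isTransposePair_QG1Qstar (𝔬 : Ops g B X Y Z W) (U : B.Cfg) (hI : Identities 𝔬 U) (hG1 : IsTransposePair (𝔬.G1 U) (𝔬.G1 U)) :
    IsTransposePair (𝔬.Q U ∘ₗ 𝔬.G1 U ∘ₗ 𝔬.Qstar U) (𝔬.Q U ∘ₗ 𝔬.G1 U ∘ₗ 𝔬.Qstar U) := by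
  have hQ : IsTransposePair (𝔬.Q U) (𝔬.Qstar U) := fun f b => hI.adjQ f b
  exact ((hQ.symm.comp hG1).comp hQ).congr_right rfl

/-- **C₁ = (QG₁Q*)⁻¹ is symmetric**: the right inverse (`Identities.c1_inv`) of the symmetric QG₁Q* on the finite coarse lattice. [cite: Balaban1985BackgroundPropagators, (3.132) p.422, (3.147) p.425] -/
theorem isTransposePair_C1 (𝔬 : Ops g B X Y Z W) (U : B.Cfg) (hI : Identities 𝔬 U) (hG1 : IsTransposePair (𝔬.G1 U) (𝔬.G1 U)) :
    IsTransposePair (𝔬.C1 U) (𝔬.C1 U) := by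
  have hN := isTransposePair_QG1Qstar 𝔬 U hI hG1
  have hinv : (𝔬.Q U ∘ₗ 𝔬.G1 U ∘ₗ 𝔬.Qstar U) ∘ₗ 𝔬.C1 U = LinearMap.id := hI.c1_inv
  exact isTransposePair_of_rightInverse hN hinv hinv

/-- ★ **(𝔓*)ᵗ = 𝔓**: the transpose of 𝔓* = I − Q*(QG₁Q*)⁻¹QG₁ − DRD*G₁ ((3.153)) is 𝔓 = I − G₁Q*(QG₁Q*)⁻¹Q − G₁DRD* ((3.147)), given G₁ and (QG₁Q*)⁻¹ symmetric, Q* the adjoint of Q,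
D* of D (in DRD*) and R symmetric (`Identities.adjQ`, `adjDv`, `symmR`). [cite: Balaban1985BackgroundPropagators, (3.147) p.425, (3.153) p.426] -/
theorem isTransposePair_frakPstar_frakP (𝔬 : Ops g B X Y Z W) (U : B.Cfg) (hI : Identities 𝔬 U) (hG1 : IsTransposePair (𝔬.G1 U) (𝔬.G1 U))
    (hC1 : IsTransposePair (𝔬.C1 U) (𝔬.C1 U)) : IsTransposePair (frakPstar 𝔬 U) (frakP 𝔬 U) := by
  have hQ : IsTransposePair (𝔬.Q U) (𝔬.Qstar U) := fun f b => hI.adjQ f b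
  have hDv : IsTransposePair (𝔬.Dv U) (𝔬.Dvstar U) := fun s f => hI.adjDv s f
  have hR : IsTransposePair (𝔬.R U) (𝔬.R U) := fun s t => hI.symmR s t
  have h2 : IsTransposePair (𝔬.Qstar U ∘ₗ 𝔬.C1 U ∘ₗ 𝔬.Q U ∘ₗ 𝔬.G1 U) (𝔬.G1 U ∘ₗ 𝔬.Qstar U ∘ₗ 𝔬.C1 U ∘ₗ 𝔬.Q U) :=
    (((hG1.comp hQ).comp hC1).comp hQ.symm).congr_right rfl
  have h3 : IsTransposePair (𝔬.Dv U ∘ₗ 𝔬.R U ∘ₗ 𝔬.Dvstar U ∘ₗ 𝔬.G1 U) (𝔬.G1 U ∘ₗ 𝔬.Dv U ∘ₗ 𝔬.R U ∘ₗ 𝔬.Dvstar U) :=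
    (((hG1.comp hDv.symm).comp hR).comp hDv).congr_right rfl
  exact (isTransposePair_id.sub h2).sub h3

/-- ★★ **𝔊 = G₁𝔓* is symmetric**: (G₁𝔓*)ᵗ = 𝔓G₁ = G₁𝔓* ((3.153), `Identities.eq153` with the pure-algebra identity `G1_comp_frakPstar`). [cite: Balaban1985BackgroundPropagators, (3.153) p.426, Thm 3.13 p.426] -/
theorem isTransposePair_GG (𝔬 : Ops g B X Y Z W) (U : B.Cfg) (hI : Identities 𝔬 U) (hG1 : IsTransposePair (𝔬.G1 U) (𝔬.G1 U))
    (hC1 : IsTransposePair (𝔬.C1 U) (𝔬.C1 U)) : IsTransposePair (𝔬.GG U) (𝔬.GG U) := by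
  have h : IsTransposePair (𝔬.G1 U ∘ₗ frakPstar 𝔬 U) (frakP 𝔬 U ∘ₗ 𝔬.G1 U) :=
    (isTransposePair_frakPstar_frakP 𝔬 U hI hG1 hC1).comp hG1
  rw [hI.eq153]
  exact h.congr_right (G1_comp_frakPstar 𝔬 U).symm

variable [Fintype Y]

/-- ★★ **THE `hsymGG` CONJUNCTION AT ONE (member, U)**: 𝔊(U) symmetric and (∇_U𝔊)ᵗ = 𝔊∇*_U, from `Identities 𝔬 U` and the four letter symmetries (Δ_a, Δ′_π, Δ⁽²⁾_π symmetric;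
∇*_U the adjoint of ∇_U) — the body of `…N06LeavesRecordNormG.normG_row_of_recordObligations`' row `hsymGG`. [cite: Balaban1985BackgroundPropagators, (3.153) p.426, Thm 3.13 p.426, p.391] -/
theorem symGG_of_identities (𝔬 : Ops g B X Y Z W) (U : B.Cfg) (hI : Identities 𝔬 U)
    (hS0 : IsTransposePair (𝔬.S0 U) (𝔬.S0 U)) (hTpi : IsTransposePair (𝔬.Tpi U) (𝔬.Tpi U)) (hT2 : IsTransposePair (𝔬.T2 U) (𝔬.T2 U))
    (hD : IsTransposePair (𝔬.D U) (𝔬.Dstar U)) :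
    IsTransposePair (𝔬.GG U) (𝔬.GG U) ∧ IsTransposePair (𝔬.D U ∘ₗ 𝔬.GG U) (𝔬.GG U ∘ₗ 𝔬.Dstar U) := by
  have hG1 := isTransposePair_G1 𝔬 U hI hS0 hTpi hT2
  have hGG := isTransposePair_GG 𝔬 U hI hG1 (isTransposePair_C1 𝔬 U hI hG1)
  exact ⟨hGG, hGG.comp hD⟩

/-- ★★ **THE `hsym` CONJUNCTION AT ONE (member, U)** (H-side leaf, Theorem 3.12): G(U), G₁(U) symmetric and (∇_UG)ᵗ = G∇*_U, (∇_UG₁)ᵗ = G₁∇*_U, from `Identities 𝔬 U` and the four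
letter symmetries — the body of `…N06LeavesRecordNormH1.normH₁_row_of_recordObligations`' row `hsym`. [cite: Balaban1985BackgroundPropagators, (3.122) p.420, (3.128) p.421, Thm 3.12 p.423, p.391] -/
theorem symG_G1_of_identities (𝔬 : Ops g B X Y Z W) (U : B.Cfg) (hI : Identities 𝔬 U)
    (hS0 : IsTransposePair (𝔬.S0 U) (𝔬.S0 U)) (hTpi : IsTransposePair (𝔬.Tpi U) (𝔬.Tpi U)) (hT2 : IsTransposePair (𝔬.T2 U) (𝔬.T2 U))
    (hD : IsTransposePair (𝔬.D U) (𝔬.Dstar U)) :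
    (IsTransposePair (𝔬.G U) (𝔬.G U) ∧ IsTransposePair (𝔬.G1 U) (𝔬.G1 U)) ∧
      (IsTransposePair (𝔬.D U ∘ₗ 𝔬.G U) (𝔬.G U ∘ₗ 𝔬.Dstar U) ∧ IsTransposePair (𝔬.D U ∘ₗ 𝔬.G1 U) (𝔬.G1 U ∘ₗ 𝔬.Dstar U)) := by
  have hG := isTransposePair_G 𝔬 U hI hS0 hTpi
  have hG1 := isTransposePair_G1 𝔬 U hI hS0 hTpi hT2
  exact ⟨⟨hG, hG1⟩, hG.comp hD, hG1.comp hD⟩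

end OneMember

/-! ## §2 The displayed rows of the T³ leaves, in their own shape, over any index family -/

section Family

variable {I : Type} {geo : I → B9.Geometry} {bg : I → B9.Backgrounds} {X Y Z W : I → Type}
variable [∀ i, Fintype (X i)] [∀ i, Fintype (Y i)] [∀ i, Fintype (Z i)] [∀ i, Fintype (W i)]

/-- ★★★ **THE ROW `hsymGG` OF THE 𝔊-SIDE LEAF FROM AN `Identities` ROW AND A LETTER-SYMMETRY ROW** (same provisos `M₁ ≤ M`, `0 < α₀`, `Mα₀ ≤ a₁`, (3.35), (3.36)): for every member
whose letters satisfy `Identities (𝔬 i) U` (at the T³ index: the last conjunct of the leaf's `hmodel`) and whose Δ_a, Δ′_π, Δ⁽²⁾_π are symmetric with ∇*_U the adjoint of ∇_U, the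
displayed conclusion `IsTransposePair (GG U) (GG U) ∧ IsTransposePair (D U ∘ₗ GG U) (GG U ∘ₗ Dstar U)` — verbatim the binder `hsymGG` of `normG_row_of_recordObligations` at
`I := KIdx 2 ℓ hd3 hL 1 1`, `geo := geo9K`, `bg := bgT3`. [cite: Balaban1985BackgroundPropagators, Thm 3.13 p.426, (3.153) p.426] -/
theorem hsymGG_row_of_letterSymm (𝔬 : ∀ i, Ops (geo i) (bg i) (X i) (Y i) (Z i) (W i)) (c35 a₁ M₁ : ℝ)
    (hId : ∀ i, M₁ ≤ (geo i).M → ∀ α₀ : ℝ, 0 < α₀ → (geo i).M * α₀ ≤ a₁ →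
      ∀ U : (bg i).Cfg, (bg i).Reg335 c35 α₀ U → (bg i).Reg336 c35 α₀ U → Identities (𝔬 i) U)
    (hls : ∀ i, M₁ ≤ (geo i).M → ∀ α₀ : ℝ, 0 < α₀ → (geo i).M * α₀ ≤ a₁ →
      ∀ U : (bg i).Cfg, (bg i).Reg335 c35 α₀ U → (bg i).Reg336 c35 α₀ U →
        IsTransposePair ((𝔬 i).S0 U) ((𝔬 i).S0 U) ∧ IsTransposePair ((𝔬 i).Tpi U) ((𝔬 i).Tpi U) ∧
          IsTransposePair ((𝔬 i).T2 U) ((𝔬 i).T2 U) ∧ IsTransposePair ((𝔬 i).D U) ((𝔬 i).Dstar U)) :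
    ∀ i, M₁ ≤ (geo i).M → ∀ α₀ : ℝ, 0 < α₀ → (geo i).M * α₀ ≤ a₁ →
      ∀ U : (bg i).Cfg, (bg i).Reg335 c35 α₀ U → (bg i).Reg336 c35 α₀ U →
        IsTransposePair ((𝔬 i).GG U) ((𝔬 i).GG U) ∧ IsTransposePair ((𝔬 i).D U ∘ₗ (𝔬 i).GG U) ((𝔬 i).GG U ∘ₗ (𝔬 i).Dstar U) := by
  intro i hM α₀ hα hMa U h5 h6
  obtain ⟨hS0, hTpi, hT2, hD⟩ := hls i hM α₀ hα hMa U h5 h6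
  exact symGG_of_identities (𝔬 i) U (hId i hM α₀ hα hMa U h5 h6) hS0 hTpi hT2 hD

/-- ★★★ **THE ROW `hsym` OF THE H-SIDE LEAF FROM AN `Identities` ROW AND A LETTER-SYMMETRY ROW** (same provisos): verbatim the binder `hsym` of
`normH₁_row_of_recordObligations` ∕ `normH_row_of_recordObligations_H` at `I := KIdx 2 ℓ hd3 hL 1 1`, `geo := geo9K`, `bg := bgT3`. [cite: Balaban1985BackgroundPropagators, Thm 3.12 p.423, (3.122) p.420, (3.128) p.421] -/
theorem hsym_row_of_letterSymm (𝔬 : ∀ i, Ops (geo i) (bg i) (X i) (Y i) (Z i) (W i)) (c35 a₁ M₁ : ℝ)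
    (hId : ∀ i, M₁ ≤ (geo i).M → ∀ α₀ : ℝ, 0 < α₀ → (geo i).M * α₀ ≤ a₁ →
      ∀ U : (bg i).Cfg, (bg i).Reg335 c35 α₀ U → (bg i).Reg336 c35 α₀ U → Identities (𝔬 i) U)
    (hls : ∀ i, M₁ ≤ (geo i).M → ∀ α₀ : ℝ, 0 < α₀ → (geo i).M * α₀ ≤ a₁ →
      ∀ U : (bg i).Cfg, (bg i).Reg335 c35 α₀ U → (bg i).Reg336 c35 α₀ U →
        IsTransposePair ((𝔬 i).S0 U) ((𝔬 i).S0 U) ∧ IsTransposePair ((𝔬 i).Tpi U) ((𝔬 i).Tpi U) ∧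
          IsTransposePair ((𝔬 i).T2 U) ((𝔬 i).T2 U) ∧ IsTransposePair ((𝔬 i).D U) ((𝔬 i).Dstar U)) :
    ∀ i, M₁ ≤ (geo i).M → ∀ α₀ : ℝ, 0 < α₀ → (geo i).M * α₀ ≤ a₁ →
      ∀ U : (bg i).Cfg, (bg i).Reg335 c35 α₀ U → (bg i).Reg336 c35 α₀ U →
        (IsTransposePair ((𝔬 i).G U) ((𝔬 i).G U) ∧ IsTransposePair ((𝔬 i).G1 U) ((𝔬 i).G1 U)) ∧
        (IsTransposePair ((𝔬 i).D U ∘ₗ (𝔬 i).G U) ((𝔬 i).G U ∘ₗ (𝔬 i).Dstar U) ∧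
          IsTransposePair ((𝔬 i).D U ∘ₗ (𝔬 i).G1 U) ((𝔬 i).G1 U ∘ₗ (𝔬 i).Dstar U)) := by
  intro i hM α₀ hα hMa U h5 h6
  obtain ⟨hS0, hTpi, hT2, hD⟩ := hls i hM α₀ hα hMa U h5 h6
  exact symG_G1_of_identities (𝔬 i) U (hId i hM α₀ hα hMa U h5 h6) hS0 hTpi hT2 hD

end Family

end Summit.QuantumFields.YangMills.Theorems.Prop7SectET3OpsSymmetry
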